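import Summits.QuantumFields.YangMills.Theorems.BalabanUVNodesN15BackgroundMatrixByPartsTwoSided
import Summits.QuantumFields.YangMills.Theorems.BalabanUVNodesN15BackgroundMatrixByPartsLayer
import HarnessLib

/-!
# THE BACKGROUND-LIVE OPERATOR LAYER WITH ENTRY 2 BY PARTS — NON-ABELIAN (MATRIX) SPECIES WITH BOTH BOND ORIENTATIONS: the carrier over the doubled direction set
# `J ⊕ J`, the realised instance and kernel family, and ENTRY 2 UNDER THE GUARD FROM THE `U ≡ 1` LETTERS, NO MIXED PIECE (dag-n15-c g9, FILE 19; Track-A node N15 = NE2, s1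
# «background-layer OPERATOR ingredient»)

`--kind proof --supports stmt-QuantumFields-20544 --as helper` (K3⁷; count-neutral).  Imports BY NAME this seat's FILE 18 `…N15BackgroundMatrixByPartsTwoSided` (`e2OpMBP₂`'s algebra:
`byPartsMult_matrix₂`, `e0_comp_fgradAdj_eq_e2ByParts_matrix₂`, `hasMaj_byPartsMult_matrix₂`, `hasMaj_idef_byPartsMult_matrix₂`, `hasMaj_mmulOp_translate_fwd`,
`hasMaj_idef_mmulOp_translate_fwd`) and g8 FILE 13 `…N15BackgroundMatrixByPartsLayer` (through it FILE 12 `fgradMat` ∕ `hasMaj_mmulOp_translate` ∕ `hasMaj_idef_mmulOp_translate`, FILE 7a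
`mKOf_mul` ∕ `mBOf_mul` ∕ `bgConst`, FILE 3 ★★ `hasMaj_idef_entry2_of_letters`, M1 `coeffBgM₁` ∕ `avgM₁` ∕ `rowLetters_of_reg335M` ∕ `hasMaj_entry01_backgroundM₁` ∕ `unstackM` ∕ `bgPairM` ∕
`hasMaj_unstackM`, B1a `hasMaj_bgPropV`); nothing in the tree is modified.

WHAT.  The two-sided twin of FILE 13.  §1 the carrier `coeffBgMBP₂ J ι π τ τ′ n n′ M θ`: a matrix coefficient family `U = (C′, Â′)` with `Â′ : J ⊕ J → (X′ → Matrix ι ι ℝ)` (forward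
coefficients `A′_μ = Â′(inl μ)`, backward coefficients `B′_μ = Â′(inr μ)` — the shape of Bałaban's (3.52) `a⁺_μ`, `a⁻_μ`) is regular iff M1's entrywise sup ∕ block-oscillation pair holds
over `J ⊕ J` AND the by-parts clauses hold: forward (FILE 13's five: coarse ∕ fine gradients, translated fit along `e_μ⁻¹`, translated derivative fit, coarse one-step oscillation) and
backward (four: coarse ∕ fine gradients, translated fit along `e_μ`, UNTRANSLATED derivative fit); `reg335_coeffBgM₁_of_MBP₂`, `bpRowLetters_of_reg335M₂`.  Pairing ∕ instance
(`bgInstanceMBP₂`).  §2 the four entry operators `bgOpsMBP₂`: entries 0∕1 from M1's `bgPairM` over `J ⊕ J` (derived pieces: forward on `inl`, backward on `inr`; entry 1 read on the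
forward piece `inl ν`), ENTRY 2 = the η-defect of the two-sided by-parts object `e2OpMBP₂` (multiplier `M_{C − Σ_μ[(∇A)∘e⁻¹ + ∇B]}`, rows `S_μM_{A_μ∘e_μ⁻¹} + M_{B_μ∘e_μ}`) read on `ι_ν`,
entry 3 from `bgDerivedV`; `bgFamilyMBP₂`.  §3 the constant `bpConst2₂` and ★★ `hasMaj_entry2_byParts_matrix₂`: under M1's guard at `J ⊕ J` and the by-parts smallness, from the
`U ≡ 1` letters on the product carrier (pieces, derived pieces over `J ⊕ J`, `G∇_ν*`, their η-defects, the shifts) and ONE shift-defect row letter (forward rows only — the backward rows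
carry no shift): the entry-2 operator at `U` obeys `≤ bpConst2₂(|J|, |J ⊕ J|, β, c_r, m₀, c₃₅|ι|, a₀, c_T, m_T)·θ·e^{−(δ−6σ)d}` — FILE 3 ★★ with its `C^b` slots LIVE.

HONEST FRAMING.  The by-parts device over (3.52)'s species IN COORDINATES, BOTH orientations, coefficients = free matrix fields, linearised entrywise transport (C3); the `U ≡ 1` layer
DISPLAYED; nothing about `G(U)` asserted; NE2⁺ NOT PRINTED; N15 not discharged; nothing continuum ∕ OS ∕ mass-gap ∕ Clay.
-/

noncomputable section

open scoped BigOperators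
open Finset

namespace Summit.QuantumFields.YangMills.BalabanUVNodes.N15.BackgroundLayer

open Literature.MathematicalPhysics.QuantumFieldTheory.Balaban1983to89
open Literature.MathematicalPhysics.QuantumFieldTheory.Balaban1983to89.B11SectG (BlockNorm HasMaj RowSum hasMaj_comp hasMaj_comp_exp hasMaj_zero)
open Literature.MathematicalPhysics.QuantumFieldTheory.Balaban1983to89.T4EtaRate (PairedInstance EtaPairing EtaRateIneq342 NE2PlusOperator rateFactor)
open Literature.MathematicalPhysics.QuantumFieldTheory.Balaban1983to89.T4EtaRateDefect (idef idef_apply idef_comp rateWeight)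
open Literature.MathematicalPhysics.QuantumFieldTheory.Balaban1983to89.T4EtaRateCoeffDefect (pull pull_apply diagK diagK_nonneg FibreOsc blockAvg fit_blockAvg)
open Literature.MathematicalPhysics.QuantumFieldTheory.Balaban1983to89.B6RandomWalk (Triangle254)
open Literature.MathematicalPhysics.QuantumFieldTheory.Balaban1983to89.B9SectDSup (inv_one_sub_le_two)
open Summit.QuantumFields.YangMills.BalabanUVNodes.N15.OperatorReadout (opGeo opFamily)
open Summit.QuantumFields.YangMills.BalabanUVNodes.N15.MatrixSpecies (mmulOp mmulOp_apply liftEquiv liftMap liftBlk hasMaj_mmulOp hasMaj_idef_mmulOp)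
open Summit.QuantumFields.YangMills.BalabanUVNodes.N15.SiteLayer (hasMaj_exp_comp_diagK hasMaj_diagK_comp_exp hasMaj_add_exp hasMaj_exp_mono)

variable {d : ℕ}

/-! ## §1 The two-sided matrix by-parts carrier, its pairing and instance -/
section Carrier

variable {X X' : Type} (J ι : Type) [Fintype ι] [Fintype X'] [DecidableEq X]

/-- THE TWO-SIDED NON-ABELIAN FIRST-ORDER CARRIER WITH THE BY-PARTS LETTERS ON EVERY ENTRY: a matrix coefficient family `U = (C′, Â′)`, `Â′ : J ⊕ J → (X′ → Matrix ι ι ℝ)` (forward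
coefficients on `inl`, backward on `inr`), is `Reg335 c α₀`-regular iff M1's entrywise sup ∕ block-oscillation pair holds over `J ⊕ J` AND the forward entries obey FILE 13's five
by-parts clauses (gradients, translated fit along `e_μ⁻¹`, translated derivative fit, coarse one-step oscillation) and the backward entries the four backward ones (gradients, translated
fit along `e_μ`, untranslated derivative fit); `Reg336` repeats it; (3.37)–(3.38) inert.
[cite: Balaban1985BackgroundPropagators, (3.35)–(3.36) p.396 (shapes); (3.52) p.400 (the species with `a⁺_μ`, `a⁻_μ`: shape)] -/
def coeffBgMBP₂ (π : X' → X) (τ : J → X ≃ X) (τ' : J → X' ≃ X') (n n' M θ : ℝ) : B9.Backgrounds where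
  Cfg := (X' → Matrix ι ι ℝ) × (J ⊕ J → X' → Matrix ι ι ℝ)
  one := 0
  mul := fun U₁ U₂ => U₁ + U₂
  Reg335 := fun c α₀ U =>
    (((∀ x' i j, |U.1 x' i j| ≤ c * M * α₀) ∧ ∀ μ x' i j, |U.2 μ x' i j| ≤ c * M * α₀) ∧
      ((∀ i j, FibreOsc π (fun x' => U.1 x' i j) (fun _ => c * M * α₀ * θ)) ∧ ∀ μ i j, FibreOsc π (fun x' => U.2 μ x' i j) (fun _ => c * M * α₀ * θ))) ∧
    ((∀ μ x i j, |fgradMat n (τ μ) ((avgM₁ (J ⊕ J) ι π U).2 (Sum.inl μ)) x i j| ≤ c * M * α₀) ∧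
      (∀ μ x' i j, |fgradMat n' (τ' μ) (U.2 (Sum.inl μ)) x' i j| ≤ c * M * α₀) ∧
      (∀ μ x' i j, |U.2 (Sum.inl μ) ((τ' μ).symm x') i j - (avgM₁ (J ⊕ J) ι π U).2 (Sum.inl μ) ((τ μ).symm (π x')) i j| ≤ c * M * α₀ * θ) ∧
      (∀ μ x' i j, |fgradMat n' (τ' μ) (U.2 (Sum.inl μ)) ((τ' μ).symm x') i j -
          fgradMat n (τ μ) ((avgM₁ (J ⊕ J) ι π U).2 (Sum.inl μ)) ((τ μ).symm (π x')) i j| ≤ c * M * α₀ * θ) ∧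
      ∀ μ x i j, |(avgM₁ (J ⊕ J) ι π U).2 (Sum.inl μ) x i j - (avgM₁ (J ⊕ J) ι π U).2 (Sum.inl μ) ((τ μ).symm x) i j| ≤ c * M * α₀ * θ) ∧
    ((∀ μ x i j, |fgradMat n (τ μ) ((avgM₁ (J ⊕ J) ι π U).2 (Sum.inr μ)) x i j| ≤ c * M * α₀) ∧
      (∀ μ x' i j, |fgradMat n' (τ' μ) (U.2 (Sum.inr μ)) x' i j| ≤ c * M * α₀) ∧
      (∀ μ x' i j, |U.2 (Sum.inr μ) (τ' μ x') i j - (avgM₁ (J ⊕ J) ι π U).2 (Sum.inr μ) (τ μ (π x')) i j| ≤ c * M * α₀ * θ) ∧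
      ∀ μ x' i j, |fgradMat n' (τ' μ) (U.2 (Sum.inr μ)) x' i j - fgradMat n (τ μ) ((avgM₁ (J ⊕ J) ι π U).2 (Sum.inr μ)) (π x') i j| ≤ c * M * α₀ * θ)
  Reg336 := fun c α₀ U =>
    (((∀ x' i j, |U.1 x' i j| ≤ c * M * α₀) ∧ ∀ μ x' i j, |U.2 μ x' i j| ≤ c * M * α₀) ∧
      ((∀ i j, FibreOsc π (fun x' => U.1 x' i j) (fun _ => c * M * α₀ * θ)) ∧ ∀ μ i j, FibreOsc π (fun x' => U.2 μ x' i j) (fun _ => c * M * α₀ * θ))) ∧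
    ((∀ μ x i j, |fgradMat n (τ μ) ((avgM₁ (J ⊕ J) ι π U).2 (Sum.inl μ)) x i j| ≤ c * M * α₀) ∧
      (∀ μ x' i j, |fgradMat n' (τ' μ) (U.2 (Sum.inl μ)) x' i j| ≤ c * M * α₀) ∧
      (∀ μ x' i j, |U.2 (Sum.inl μ) ((τ' μ).symm x') i j - (avgM₁ (J ⊕ J) ι π U).2 (Sum.inl μ) ((τ μ).symm (π x')) i j| ≤ c * M * α₀ * θ) ∧
      (∀ μ x' i j, |fgradMat n' (τ' μ) (U.2 (Sum.inl μ)) ((τ' μ).symm x') i j -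
          fgradMat n (τ μ) ((avgM₁ (J ⊕ J) ι π U).2 (Sum.inl μ)) ((τ μ).symm (π x')) i j| ≤ c * M * α₀ * θ) ∧
      ∀ μ x i j, |(avgM₁ (J ⊕ J) ι π U).2 (Sum.inl μ) x i j - (avgM₁ (J ⊕ J) ι π U).2 (Sum.inl μ) ((τ μ).symm x) i j| ≤ c * M * α₀ * θ) ∧
    ((∀ μ x i j, |fgradMat n (τ μ) ((avgM₁ (J ⊕ J) ι π U).2 (Sum.inr μ)) x i j| ≤ c * M * α₀) ∧
      (∀ μ x' i j, |fgradMat n' (τ' μ) (U.2 (Sum.inr μ)) x' i j| ≤ c * M * α₀) ∧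
      (∀ μ x' i j, |U.2 (Sum.inr μ) (τ' μ x') i j - (avgM₁ (J ⊕ J) ι π U).2 (Sum.inr μ) (τ μ (π x')) i j| ≤ c * M * α₀ * θ) ∧
      ∀ μ x' i j, |fgradMat n' (τ' μ) (U.2 (Sum.inr μ)) x' i j - fgradMat n (τ μ) ((avgM₁ (J ⊕ J) ι π U).2 (Sum.inr μ)) (π x') i j| ≤ c * M * α₀ * θ)
  Cplx337 := fun _ _ _ => True
  Cplx338 := fun _ _ _ => True

omit [Fintype ι] in
/-- the carrier's (3.35) IMPLIES M1's `coeffBgM₁ (J ⊕ J)` letter pair (so M1's entries 0∕1∕3 over `J ⊕ J` apply verbatim). [folklore] -/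
theorem reg335_coeffBgM₁_of_MBP₂ {π : X' → X} {τ : J → X ≃ X} {τ' : J → X' ≃ X'} {n n' M θ c α₀ : ℝ} {U : (X' → Matrix ι ι ℝ) × (J ⊕ J → X' → Matrix ι ι ℝ)}
    (h : (coeffBgMBP₂ J ι π τ τ' n n' M θ).Reg335 c α₀ U) : (coeffBgM₁ (J ⊕ J) ι π M θ).Reg335 c α₀ U := h.1

variable {g : B6.Geometry} [Fintype X]

/-- THE η-PAIRING over the two-sided matrix by-parts carriers (NOT PRINTED data), as M1's `bgPairingM₁ (J ⊕ J)`: scale shift `m`, identity on sites, pull-back along `liftMap π ι`,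
entrywise block-averaged families. [cite: King1986, p.664 (convention before Prop. 3.8)] -/
def bgPairingMBP₂ (blk : X → g.Site) (π : X' → X) (τ : J → X ≃ X) (τ' : J → X' ≃ X') (n n' : ℝ) (m : ℕ) (hL : g.L ≠ 0) (θc θ : ℝ) :
    EtaPairing (opGeo g (X × ι) (liftBlk blk ι)) (fineGeo g (X' × ι) (liftBlk (blk ∘ π) ι) m) (coeffBgMBP₂ J ι (fun x : X => x) τ τ n n g.M θc)
      (coeffBgMBP₂ J ι π τ τ' n n' g.M θ) where
  n := m
  k_eq := rfl
  L_eq := rfl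
  M_eq := rfl
  eta_eq := (bgPairingM₁ (J ⊕ J) ι blk π m hL θc θ).eta_eq
  ι := fun y => y
  scale_ι := fun _ => rfl
  dist_ι := fun _ _ => rfl
  τ := fun lam => pull (liftMap π ι) lam
  suppIn_τ := fun _ _ h p hp => h (liftMap π ι p) hp
  supNorm_τ := (bgPairingM₁ (J ⊕ J) ι blk π m hL θc θ).supNorm_τ
  avg := avgM₁ (J ⊕ J) ι π
  avg_one := avgM₁_zero (J ⊕ J) ι π

/-- THE REALISED PAIRED INSTANCE of the two-sided by-parts non-abelian first-order layer. [cite: Balaban1985BackgroundPropagators, Thm 3.14 pp.426–427 (typing template)] -/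
def bgInstanceMBP₂ (blk : X → g.Site) (π : X' → X) (τ : J → X ≃ X) (τ' : J → X' ≃ X') (n n' : ℝ) (m : ℕ) (hL : g.L ≠ 0) (θc θ : ℝ) : PairedInstance :=
  ⟨opGeo g (X × ι) (liftBlk blk ι), fineGeo g (X' × ι) (liftBlk (blk ∘ π) ι) m, coeffBgMBP₂ J ι (fun x : X => x) τ τ n n g.M θc,
    coeffBgMBP₂ J ι π τ τ' n n' g.M θ, bgPairingMBP₂ J ι blk π τ τ' n n' m hL θc θ⟩

/-- THE GUARD IS LIVE: the fine geometry's size parameter is the datum's `M`. [folklore] -/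
theorem bgInstanceMBP₂_M (blk : X → g.Site) (π : X' → X) (τ : J → X ≃ X) (τ' : J → X' ≃ X') (n n' : ℝ) (m : ℕ) (hL : g.L ≠ 0) (θc θ : ℝ) :
    (bgInstanceMBP₂ J ι blk π τ τ' n n' m hL θc θ).gf.M = g.M := rfl

end Carrier
/-! ## §2 The four entry operators — entry 2 BY PARTS, both orientations — and the kernel family -/
section Ops

variable {X X' J ι : Type} [Fintype X] [Fintype X'] [Fintype J] [Fintype ι] [DecidableEq X] [DecidableEq X'] [DecidableEq J] [DecidableEq ι] {g : B6.Geometry}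
  (blk : X → g.Site) (π : X' → X)

/-- THE TWO-SIDED BY-PARTS DRESSED ENTRY-2 OBJECT of the matrix species at ONE spacing: `E₂ = B̂(1 + K̂)⁻¹` on the tuple carrier with `S_ν = G∇_ν*`, `E₀ = pr₀(bgPairM G D C Â)` over
`J ⊕ J`, multiplier `M_{C − Σ_μ[(∇_μA_μ)∘e_μ⁻¹ + ∇_μB_μ]}`, rows `S_μM_{A_μ∘e_μ⁻¹} + M_{B_μ∘e_μ}` (`A = Â∘inl`, `B = Â∘inr`) — which IS `E₀∘∇_ν*` on `ι_ν` (FILE 18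
`e0_comp_fgradAdj_eq_e2ByParts_matrix₂`). [cite: Balaban1985BackgroundPropagators, (3.42) p.397 (entry «G(U)∇*»: shape) + (3.52) p.400 + (3.64)–(3.65) p.402 (mechanism)] -/
def e2OpMBP₂ (τ : J → X ≃ X) (n : ℝ) (G : (X × ι → ℝ) →ₗ[ℝ] (X × ι → ℝ)) (D : J ⊕ J → (X × ι → ℝ) →ₗ[ℝ] (X × ι → ℝ)) (C : X → Matrix ι ι ℝ)
    (A : J ⊕ J → X → Matrix ι ι ℝ) : ((X × ι) × J → ℝ) →ₗ[ℝ] (X × ι → ℝ) :=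
  e2ByParts (bopOf (fun ν => G ∘ₗ fgradAdj n (liftEquiv (τ ν) ι)) (projO none ∘ₗ bgPairM G D C A)
      (mmulOp (C - ∑ μ, (fgradMat n (τ μ) (A (Sum.inl μ)) ∘ ⇑(τ μ).symm + fgradMat n (τ μ) (A (Sum.inr μ))))))
    (krowOf (fun ν => G ∘ₗ fgradAdj n (liftEquiv (τ ν) ι)) (fun μ => pull (liftEquiv (τ μ) ι)) (fun μ => mmulOp (A (Sum.inl μ) ∘ ⇑(τ μ).symm))
      (fun μ => mmulOp (A (Sum.inr μ) ∘ ⇑(τ μ))))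

/-- THE FOUR ENTRY OPERATORS OF THE TWO-SIDED BY-PARTS NON-ABELIAN PAIR at a matrix family `U` (coarse partner = entrywise block averages): entries 0∕1 = the `none` ∕ `some (inl ν)`
components of M1's `bgPairM` over `J ⊕ J`, ENTRY 2 = THE η-DEFECT OF THE TWO-SIDED BY-PARTS OBJECTS READ ON `ι_ν`, entry 3 = the derived object of `D₃`.
[cite: Balaban1985BackgroundPropagators, (3.42) p.397 (the four entries: shape)] -/
def bgOpsMBP₂ (τ : J → X ≃ X) (τ' : J → X' ≃ X') (n n' : ℝ) (ν : J) (G D₃ : (X × ι → ℝ) →ₗ[ℝ] (X × ι → ℝ)) (D : J ⊕ J → (X × ι → ℝ) →ₗ[ℝ] (X × ι → ℝ))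
    (G' D₃' : (X' × ι → ℝ) →ₗ[ℝ] (X' × ι → ℝ)) (D' : J ⊕ J → (X' × ι → ℝ) →ₗ[ℝ] (X' × ι → ℝ)) :
    Fin 4 → (X' → Matrix ι ι ℝ) × (J ⊕ J → X' → Matrix ι ι ℝ) → ((X × ι → ℝ) →ₗ[ℝ] (X' × ι → ℝ)) :=
  fun k U => ![idef (pull (liftMap π ι)) (pull (liftMap π ι)) (projO none ∘ₗ bgPairM G' D' U.1 U.2)
      (projO none ∘ₗ bgPairM G D (avgM₁ (J ⊕ J) ι π U).1 (avgM₁ (J ⊕ J) ι π U).2),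
    idef (pull (liftMap π ι)) (pull (liftMap π ι)) (projO (some (Sum.inl ν)) ∘ₗ bgPairM G' D' U.1 U.2)
      (projO (some (Sum.inl ν)) ∘ₗ bgPairM G D (avgM₁ (J ⊕ J) ι π U).1 (avgM₁ (J ⊕ J) ι π U).2),
    idef (pull (liftMap (liftMap π ι) J)) (pull (liftMap π ι)) (e2OpMBP₂ τ' n' G' D' U.1 U.2) (e2OpMBP₂ τ n G D (avgM₁ (J ⊕ J) ι π U).1 (avgM₁ (J ⊕ J) ι π U).2) ∘ₗ
      injJ ν,
    idef (pull (liftMap π ι)) (pull (liftMap π ι)) (bgDerivedV (stack G' D') D₃' (unstackM U.1 U.2))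
      (bgDerivedV (stack G D) D₃ (unstackM (avgM₁ (J ⊕ J) ι π U).1 (avgM₁ (J ⊕ J) ι π U).2))] k

/-- THE KERNEL FAMILY over the two-sided matrix by-parts carrier. [cite: Balaban1985BackgroundPropagators, (3.42) p.397 (shape)] -/
def bgFamilyMBP₂ (τ : J → X ≃ X) (τ' : J → X' ≃ X') (n n' : ℝ) (m : ℕ) (hL : g.L ≠ 0) (θc θ : ℝ) (ν : J) (G D₃ : (X × ι → ℝ) →ₗ[ℝ] (X × ι → ℝ))
    (D : J ⊕ J → (X × ι → ℝ) →ₗ[ℝ] (X × ι → ℝ)) (G' D₃' : (X' × ι → ℝ) →ₗ[ℝ] (X' × ι → ℝ)) (D' : J ⊕ J → (X' × ι → ℝ) →ₗ[ℝ] (X' × ι → ℝ)) :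
    B9.KernelFamily (bgInstanceMBP₂ J ι blk π τ τ' n n' m hL θc θ).gc (bgInstanceMBP₂ J ι blk π τ τ' n n' m hL θc θ).Bf :=
  show B9.KernelFamily (opGeo g (X × ι) (liftBlk blk ι)) (coeffBgMBP₂ J ι π τ τ' n n' g.M θ) from
    opFamily (g := g) (B := coeffBgMBP₂ J ι π τ τ' n n' g.M θ) (liftBlk blk ι) (liftBlk (blk ∘ π) ι) (bgOpsMBP₂ π τ τ' n n' ν G D₃ D G' D₃' D')

end Ops
/-! ## §3 ENTRY 2 BY PARTS under the guard, two-sided matrix species -/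
section Entry2

variable {X X' J ι : Type} [Fintype X] [Fintype X'] [Fintype J] [Fintype ι] [DecidableEq X] [DecidableEq X'] [DecidableEq J] [DecidableEq ι] [Nonempty ι]
  {g : B6.Geometry} (blk : X → g.Site) (π : X' → X)

omit [Fintype X] [Fintype J] [DecidableEq X'] [DecidableEq J] [DecidableEq ι] [Nonempty ι] in
/-- row letters of the two-sided by-parts clauses: `|ι|`× the entry letters (forward five, backward four). [folklore] -/
theorem bpRowLetters_of_reg335M₂ {τ : J → X ≃ X} {τ' : J → X' ≃ X'} {n n' M θ c α₀ : ℝ} {U : (X' → Matrix ι ι ℝ) × (J ⊕ J → X' → Matrix ι ι ℝ)}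
    (h : (coeffBgMBP₂ J ι π τ τ' n n' M θ).Reg335 c α₀ U) :
    ((∀ μ x i, ∑ j, |fgradMat n (τ μ) ((avgM₁ (J ⊕ J) ι π U).2 (Sum.inl μ)) x i j| ≤ c * M * α₀ * Fintype.card ι) ∧
      (∀ μ x' i, ∑ j, |fgradMat n' (τ' μ) (U.2 (Sum.inl μ)) x' i j| ≤ c * M * α₀ * Fintype.card ι) ∧
      (∀ μ x' i, ∑ j, |U.2 (Sum.inl μ) ((τ' μ).symm x') i j - (avgM₁ (J ⊕ J) ι π U).2 (Sum.inl μ) ((τ μ).symm (π x')) i j| ≤ c * M * α₀ * Fintype.card ι * θ) ∧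
      (∀ μ x' i, ∑ j, |fgradMat n' (τ' μ) (U.2 (Sum.inl μ)) ((τ' μ).symm x') i j -
          fgradMat n (τ μ) ((avgM₁ (J ⊕ J) ι π U).2 (Sum.inl μ)) ((τ μ).symm (π x')) i j| ≤ c * M * α₀ * Fintype.card ι * θ) ∧
      ∀ μ x i, ∑ j, |(avgM₁ (J ⊕ J) ι π U).2 (Sum.inl μ) x i j - (avgM₁ (J ⊕ J) ι π U).2 (Sum.inl μ) ((τ μ).symm x) i j| ≤ c * M * α₀ * Fintype.card ι * θ) ∧
    ((∀ μ x i, ∑ j, |fgradMat n (τ μ) ((avgM₁ (J ⊕ J) ι π U).2 (Sum.inr μ)) x i j| ≤ c * M * α₀ * Fintype.card ι) ∧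
      (∀ μ x' i, ∑ j, |fgradMat n' (τ' μ) (U.2 (Sum.inr μ)) x' i j| ≤ c * M * α₀ * Fintype.card ι) ∧
      (∀ μ x' i, ∑ j, |U.2 (Sum.inr μ) (τ' μ x') i j - (avgM₁ (J ⊕ J) ι π U).2 (Sum.inr μ) (τ μ (π x')) i j| ≤ c * M * α₀ * Fintype.card ι * θ) ∧
      ∀ μ x' i, ∑ j, |fgradMat n' (τ' μ) (U.2 (Sum.inr μ)) x' i j - fgradMat n (τ μ) ((avgM₁ (J ⊕ J) ι π U).2 (Sum.inr μ)) (π x') i j| ≤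
        c * M * α₀ * Fintype.card ι * θ) := by
  obtain ⟨-, ⟨hga, hga', hfaT, hfgT, hosc⟩, hgb, hgb', hfbT, hfgb⟩ := h
  have hrow : ∀ {f : ι → ℝ} {b : ℝ}, (∀ j, |f j| ≤ b) → ∑ j, |f j| ≤ b * Fintype.card ι := fun {f b} hf =>
    calc ∑ j, |f j| ≤ ∑ _j : ι, b := Finset.sum_le_sum fun j _ => hf j
      _ = b * Fintype.card ι := by rw [Finset.sum_const, Finset.card_univ, nsmul_eq_mul, mul_comm]
  have hθ : c * M * α₀ * Fintype.card ι * θ = c * M * α₀ * θ * Fintype.card ι := by ring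
  refine ⟨⟨fun μ x i => hrow fun j => hga μ x i j, fun μ x' i => hrow fun j => hga' μ x' i j, fun μ x' i => ?_, fun μ x' i => ?_, fun μ x i => ?_⟩,
    fun μ x i => hrow fun j => hgb μ x i j, fun μ x' i => hrow fun j => hgb' μ x' i j, fun μ x' i => ?_, fun μ x' i => ?_⟩
  · rw [hθ]; exact hrow fun j => hfaT μ x' i j
  · rw [hθ]; exact hrow fun j => hfgT μ x' i j
  · rw [hθ]; exact hrow fun j => hosc μ x i j
  · rw [hθ]; exact hrow fun j => hfbT μ x' i j
  · rw [hθ]; exact hrow fun j => hfgb μ x' i j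

/-- THE TWO-SIDED ENTRY-2 CONSTANT (U-independent): FILE 7a's `bpConst2` with the row number `nJ = |J|` of the by-parts system and the direction number `nJ′ = |J ⊕ J|` of M1's pair kept
apart. [folklore] -/
def bpConst2₂ (nJ nJ' β cr m₀ c35 a₀ cT mT : ℝ) : ℝ :=
  srcConst nJ β (β * 2) (c35 * a₀ * (1 + nJ')) cr * (1 * (1 - 1 * rowConst nJ β cT (c35 * a₀) cr * cr * cr))⁻¹ *
      mKOf nJ β cT (c35 * a₀) m₀ (c35 * a₀ * (1 + nJ')) mT cr * cr * (1 * (1 - 1 * rowConst nJ β cT (c35 * a₀) cr * cr * cr))⁻¹ * cr * cr +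
    mBOf nJ β (β * 2) (c35 * a₀ * (1 + nJ')) cr m₀ (bgConst β cr m₀ (c35 * (1 + nJ')) a₀) (c35 * a₀ * (1 + nJ')) *
      (1 * (1 - 1 * rowConst nJ β cT (c35 * a₀) cr * cr * cr))⁻¹ * cr

/-- It is non-negative for non-negative letters under the by-parts smallness. [folklore] -/
theorem bpConst2₂_nonneg {nJ nJ' β cr m₀ c35 a₀ cT mT : ℝ} (hnJ : 0 ≤ nJ) (hnJ' : 0 ≤ nJ') (hβ : 0 ≤ β) (hcr : 0 ≤ cr) (hm₀ : 0 ≤ m₀) (hc35 : 0 ≤ c35) (ha₀ : 0 ≤ a₀)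
    (hcT : 0 ≤ cT) (hmT : 0 ≤ mT) (hq : 1 * rowConst nJ β cT (c35 * a₀) cr * cr * cr < 1) : 0 ≤ bpConst2₂ nJ nJ' β cr m₀ c35 a₀ cT mT := by
  have hA : 0 ≤ (1 * (1 - 1 * rowConst nJ β cT (c35 * a₀) cr * cr * cr))⁻¹ := by
    rw [one_mul]; exact inv_nonneg.2 (by linarith)
  have h1 : 0 ≤ bgConst β cr m₀ (c35 * (1 + nJ')) a₀ := bgConst_nonneg hβ hcr hm₀ (by positivity) ha₀
  unfold bpConst2₂
  set A := (1 * (1 - 1 * rowConst nJ β cT (c35 * a₀) cr * cr * cr))⁻¹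
  set B := bgConst β cr m₀ (c35 * (1 + nJ')) a₀
  unfold srcConst mKOf mBOf
  positivity

variable {τ : J → X ≃ X} {τ' : J → X' ≃ X'} {n n' : ℝ} {G : (X × ι → ℝ) →ₗ[ℝ] (X × ι → ℝ)} {D : J ⊕ J → (X × ι → ℝ) →ₗ[ℝ] (X × ι → ℝ)}
  {G' : (X' × ι → ℝ) →ₗ[ℝ] (X' × ι → ℝ)} {D' : J ⊕ J → (X' × ι → ℝ) →ₗ[ℝ] (X' × ι → ℝ)}
set_option maxHeartbeats 400000 in
/-- ★★ **ENTRY 2 OF THE TWO-SIDED NON-ABELIAN FIRST-ORDER PAIR, BY PARTS, UNDER THE GUARD** — NO MIXED PIECE.  Data: a [B6] carrier ((2.54), `d ≥ 0`, `d(y,y) = 0`, (2.61) at `σ ≥ 0`,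
`6σ ≤ δ`); lattices `X, X′` paired by `π`, colour components `ι` (nonempty), translations `τ, τ′` at reciprocal spacings `n, n′` lifted to the product carriers; the `U ≡ 1` LAYER on
the product carriers at rate `δ`: pieces `G, G′`, derived pieces `D_ĵ, D′_ĵ` over `ĵ ∈ J ⊕ J` (forward on `inl`, backward on `inr`) `≤ βe^{−δd}` with defects `m₀θe^{−δd}`, the `U ≡ 1`
ENTRY-2 operators `G∇_ν*, G′∇′_ν*` `≤ βe^{−δd}` with defects `≤ m₀θe^{−δd}`, the shifts `≤ c_Te^{−δd}`; a `Reg335`-regular family `U` of `coeffBgMBP₂` under M1's guard at `J ⊕ J`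
(`c₃₅ > 0`, `β(c₃₅|ι|(1+|J ⊕ J|)a₀)c_r ≤ ½`, `M ≥ 1`, `Mα₀ ≤ a₀`) and the by-parts smallness `rowConst(|J|, β, c_T, c₃₅|ι|a₀, c_r)·c_r² ≤ ½`; and THE SHIFT-DEFECT ROW LETTER at `U` on the
forward rows (`≤ m_Tθe^{−δd}`).  CONCLUSION: the entry-2 operator of `bgOpsMBP₂` at `U` obeys `≤ bpConst2₂(|J|, |J ⊕ J|, β, c_r, m₀, c₃₅|ι|, a₀, c_T, m_T)·θ·e^{−(δ−6σ)d}`.  FILE 3 ★★ with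
`E₀′` = B1a's Neumann bound over `hasMaj_unstackM` at `J ⊕ J`, `𝔇(E₀′,E₀)` = M1 `hasMaj_entry01_backgroundM₁` at `J ⊕ J`, multiplier ∕ forward ∕ BACKWARD coefficient letters = FILE 18
on the row letters. [cite: Balaban1985BackgroundPropagators, Thm 3.1 (3.42) p.397 (entry «G(U)∇*»: shape) + (3.52) p.400 + (3.64)–(3.65) p.402 (mechanism)] -/
theorem hasMaj_entry2_byParts_matrix₂ (htri : Triangle254 g) (hd : ∀ a b : g.Site, 0 ≤ g.dist a b) (hd0 : ∀ y : g.Site, g.dist y y = 0) {σ cr : ℝ} (hσ : 0 ≤ σ)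
    (hcr : 0 ≤ cr) (hrow : RowSum g σ cr) {δ β m₀ θ c35 a₀ M α₀ cT mT : ℝ} (hσδ : 6 * σ ≤ δ) (hβ : 0 ≤ β) (hm₀ : 0 ≤ m₀) (hθ : 0 ≤ θ) (hc35 : 0 < c35)
    (ha₀ : 0 ≤ a₀) (hq : β * (c35 * (Fintype.card ι * (1 + Fintype.card (J ⊕ J))) * a₀) * cr ≤ 1 / 2) (hM : 1 ≤ M) (hα₀ : 0 < α₀) (hMα : M * α₀ ≤ a₀)
    (hcT : 0 ≤ cT) (hmT : 0 ≤ mT) (hq2 : 1 * rowConst (Fintype.card J) β cT (c35 * Fintype.card ι * a₀) cr * cr * cr ≤ 1 / 2)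
    (hG : HasMaj (BlockNorm.ofBlocks g (liftBlk blk ι)) (BlockNorm.ofBlocks g (liftBlk blk ι)) G (fun y y' => β * Real.exp (-(δ * g.dist y y'))))
    (hD : ∀ μ, HasMaj (BlockNorm.ofBlocks g (liftBlk blk ι)) (BlockNorm.ofBlocks g (liftBlk blk ι)) (D μ) (fun y y' => β * Real.exp (-(δ * g.dist y y'))))
    (hG' : HasMaj (BlockNorm.ofBlocks g (liftBlk (blk ∘ π) ι)) (BlockNorm.ofBlocks g (liftBlk (blk ∘ π) ι)) G' (fun y y' => β * Real.exp (-(δ * g.dist y y'))))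
    (hD' : ∀ μ, HasMaj (BlockNorm.ofBlocks g (liftBlk (blk ∘ π) ι)) (BlockNorm.ofBlocks g (liftBlk (blk ∘ π) ι)) (D' μ)
      (fun y y' => β * Real.exp (-(δ * g.dist y y'))))
    (hDG : HasMaj (BlockNorm.ofBlocks g (liftBlk blk ι)) (BlockNorm.ofBlocks g (liftBlk (blk ∘ π) ι)) (idef (pull (liftMap π ι)) (pull (liftMap π ι)) G' G)
      (fun y y' => m₀ * θ * Real.exp (-(δ * g.dist y y'))))
    (hDD : ∀ μ, HasMaj (BlockNorm.ofBlocks g (liftBlk blk ι)) (BlockNorm.ofBlocks g (liftBlk (blk ∘ π) ι))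
      (idef (pull (liftMap π ι)) (pull (liftMap π ι)) (D' μ) (D μ)) (fun y y' => m₀ * θ * Real.exp (-(δ * g.dist y y'))))
    (hS : ∀ ν, HasMaj (BlockNorm.ofBlocks g (liftBlk blk ι)) (BlockNorm.ofBlocks g (liftBlk blk ι)) (G ∘ₗ fgradAdj n (liftEquiv (τ ν) ι))
      (fun y y' => β * Real.exp (-(δ * g.dist y y'))))
    (hS' : ∀ ν, HasMaj (BlockNorm.ofBlocks g (liftBlk (blk ∘ π) ι)) (BlockNorm.ofBlocks g (liftBlk (blk ∘ π) ι)) (G' ∘ₗ fgradAdj n' (liftEquiv (τ' ν) ι))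
      (fun y y' => β * Real.exp (-(δ * g.dist y y'))))
    (hDS : ∀ ν, HasMaj (BlockNorm.ofBlocks g (liftBlk blk ι)) (BlockNorm.ofBlocks g (liftBlk (blk ∘ π) ι))
      (idef (pull (liftMap π ι)) (pull (liftMap π ι)) (G' ∘ₗ fgradAdj n' (liftEquiv (τ' ν) ι)) (G ∘ₗ fgradAdj n (liftEquiv (τ ν) ι)))
      (fun y y' => m₀ * θ * Real.exp (-(δ * g.dist y y'))))
    (hSh : ∀ μ, HasMaj (BlockNorm.ofBlocks g (liftBlk blk ι)) (BlockNorm.ofBlocks g (liftBlk blk ι)) (pull (liftEquiv (τ μ) ι))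
      (fun y y' => cT * Real.exp (-(δ * g.dist y y'))))
    (hSh' : ∀ μ, HasMaj (BlockNorm.ofBlocks g (liftBlk (blk ∘ π) ι)) (BlockNorm.ofBlocks g (liftBlk (blk ∘ π) ι)) (pull (liftEquiv (τ' μ) ι))
      (fun y y' => cT * Real.exp (-(δ * g.dist y y'))))
    {U : (X' → Matrix ι ι ℝ) × (J ⊕ J → X' → Matrix ι ι ℝ)} (hreg : (coeffBgMBP₂ J ι π τ τ' n n' M θ).Reg335 c35 α₀ U)
    (hDSh : ∀ μ, HasMaj (BlockNorm.ofBlocks g (liftBlk (liftBlk blk ι) J)) (BlockNorm.ofBlocks g (liftBlk (blk ∘ π) ι))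
      (idef (pull (liftMap π ι)) (pull (liftMap π ι)) (pull (liftEquiv (τ' μ) ι)) (pull (liftEquiv (τ μ) ι)) ∘ₗ
        (mmulOp ((avgM₁ (J ⊕ J) ι π U).2 (Sum.inl μ) ∘ ⇑(τ μ).symm) ∘ₗ sumJ fun ν => G ∘ₗ fgradAdj n (liftEquiv (τ ν) ι)))
      (fun y y' => mT * θ * Real.exp (-(δ * g.dist y y'))))
    (ν : J) :
    HasMaj (BlockNorm.ofBlocks g (liftBlk blk ι)) (BlockNorm.ofBlocks g (liftBlk (blk ∘ π) ι))
      (idef (pull (liftMap (liftMap π ι) J)) (pull (liftMap π ι)) (e2OpMBP₂ τ' n' G' D' U.1 U.2) (e2OpMBP₂ τ n G D (avgM₁ (J ⊕ J) ι π U).1 (avgM₁ (J ⊕ J) ι π U).2) ∘ₗ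
        injJ ν)
      (fun y y' => bpConst2₂ (Fintype.card J) (Fintype.card (J ⊕ J)) β cr m₀ (c35 * Fintype.card ι) a₀ cT mT * θ * Real.exp (-((δ - 6 * σ) * g.dist y y'))) := by
  have hreg₁ : (coeffBgM₁ (J ⊕ J) ι π M θ).Reg335 c35 α₀ U := reg335_coeffBgM₁_of_MBP₂ J ι hreg
  -- row letters
  set r : ℝ := c35 * M * α₀ with hr_def
  have hι1 : (1 : ℝ) ≤ Fintype.card ι := by exact_mod_cast Fintype.card_pos
  have hι0 : (0 : ℝ) ≤ Fintype.card ι := zero_le_one.trans hι1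
  have hnJ : (0 : ℝ) ≤ Fintype.card J := Nat.cast_nonneg _
  have hnJ2 : (0 : ℝ) ≤ Fintype.card (J ⊕ J) := Nat.cast_nonneg _
  have hJ2 : (Fintype.card (J ⊕ J) : ℝ) = Fintype.card J + Fintype.card J := by rw [Fintype.card_sum]; push_cast; ring
  have hJ0 : (0 : ℝ) ≤ 1 + Fintype.card (J ⊕ J) := by positivity
  have hM0 : 0 ≤ M := zero_le_one.trans hM
  have hr0 : 0 ≤ r := by positivity
  obtain ⟨hc, ha, hc', ha', hfc, hfa⟩ := rowLetters_of_reg335M (J := J ⊕ J) (ι := ι) π hr0 hreg₁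
  obtain ⟨⟨hga, hga', hfaT, hfgT, hosc⟩, hgb, hgb', hfbT, hfgb⟩ := bpRowLetters_of_reg335M₂ π hreg
  set r' : ℝ := r * Fintype.card ι with hr'_def
  have hr'0 : 0 ≤ r' := mul_nonneg hr0 hι0
  have hca0 : 0 ≤ c35 * Fintype.card ι * a₀ := by positivity
  have hra : r' ≤ c35 * Fintype.card ι * a₀ := by
    rw [hr'_def, hr_def]
    calc c35 * M * α₀ * Fintype.card ι = c35 * Fintype.card ι * (M * α₀) := by ring
      _ ≤ c35 * Fintype.card ι * a₀ := mul_le_mul_of_nonneg_left hMα (by positivity)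
  have hσδ' : σ ≤ δ := by linarith
  -- (E₀′): the fine dressed propagator's majorant `≤ 2β·e^{−(δ−σ)d}`
  have hRa : r' * (1 + Fintype.card (J ⊕ J)) ≤ c35 * (Fintype.card ι * (1 + Fintype.card (J ⊕ J))) * a₀ := by
    calc r' * (1 + Fintype.card (J ⊕ J)) ≤ c35 * Fintype.card ι * a₀ * (1 + Fintype.card (J ⊕ J)) := mul_le_mul_of_nonneg_right hra hJ0
      _ = c35 * (Fintype.card ι * (1 + Fintype.card (J ⊕ J))) * a₀ := by ring
  have hR0 : 0 ≤ r' * (1 + Fintype.card (J ⊕ J)) := mul_nonneg hr'0 hJ0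
  have hq' : β * (r' * (1 + Fintype.card (J ⊕ J))) * cr ≤ 1 / 2 := (mul_le_mul_of_nonneg_right (mul_le_mul_of_nonneg_left hRa hβ) hcr).trans hq
  have hq1 : β * (r' * (1 + Fintype.card (J ⊕ J))) * cr < 1 := by linarith
  have hinv : (1 - β * (r' * (1 + Fintype.card (J ⊕ J))) * cr)⁻¹ ≤ 2 := inv_one_sub_le_two hq'
  have hV' : HasMaj (BlockNorm.ofBlocks g (blkPair (liftBlk (blk ∘ π) ι))) (BlockNorm.ofBlocks g (liftBlk (blk ∘ π) ι)) (unstackM U.1 U.2)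
      (diagK fun _ => r' * (1 + Fintype.card (J ⊕ J))) := hasMaj_unstackM (blk ∘ π) hr'0 hc' ha'
  have hSG' := hasMaj_stack (liftBlk (blk ∘ π) ι) (fun _ _ => mul_nonneg hβ (Real.exp_nonneg _)) hG' hD'
  have hX' := hasMaj_bgPropV (liftBlk (blk ∘ π) ι) (blkPair (liftBlk (blk ∘ π) ι)) htri hd hrow hσ (ρ := δ - σ) (by linarith) (by linarith) hβ hR0 hSG' hV' hq1
  have hE' : HasMaj (BlockNorm.ofBlocks g (liftBlk (blk ∘ π) ι)) (BlockNorm.ofBlocks g (liftBlk (blk ∘ π) ι)) (projO none ∘ₗ bgPairM G' D' U.1 U.2)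
      (fun y y' => β * 2 * Real.exp (-((δ - σ) * g.dist y y'))) :=
    (hasMaj_projO_comp (liftBlk (blk ∘ π) ι) hX' none).mono fun y y' =>
      mul_le_mul_of_nonneg_right (mul_le_mul_of_nonneg_left hinv hβ) (Real.exp_nonneg _)
  -- (𝔇E₀): M1's entry 0 over `J ⊕ J`
  have hDE := hasMaj_entry01_backgroundM₁ blk π htri hd hσ hcr hrow hσδ' hβ hm₀ hθ hc35 hq hM hα₀ hMα hG hD hG' hD' hDG hDD hreg₁ none
  -- multiplier letters (FILE 18), weakened to the guard
  have hdiag : ∀ {t t' : ℝ}, t ≤ t' → ∀ y y' : g.Site, diagK (fun _ => t) y y' ≤ diagK (fun _ => t') y y' :=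
    fun h y y' => T4EtaRateCoeffDefect.diagK_mono (fun _ => h) y y'
  have hrR : r' + Fintype.card J * (r' + r') ≤ c35 * Fintype.card ι * a₀ * (1 + Fintype.card (J ⊕ J)) := by rw [hJ2]; nlinarith
  have hR : HasMaj (BlockNorm.ofBlocks g (liftBlk blk ι)) (BlockNorm.ofBlocks g (liftBlk blk ι))
      (mmulOp ((avgM₁ (J ⊕ J) ι π U).1 - ∑ μ, (fgradMat n (τ μ) ((avgM₁ (J ⊕ J) ι π U).2 (Sum.inl μ)) ∘ ⇑(τ μ).symm +
        fgradMat n (τ μ) ((avgM₁ (J ⊕ J) ι π U).2 (Sum.inr μ)))))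
      (diagK fun _ => c35 * Fintype.card ι * a₀ * (1 + Fintype.card (J ⊕ J))) :=
    (hasMaj_byPartsMult_matrix₂ blk (A := fun μ => (avgM₁ (J ⊕ J) ι π U).2 (Sum.inl μ)) (B := fun μ => (avgM₁ (J ⊕ J) ι π U).2 (Sum.inr μ)) hr'0 hr'0 hc hga
      hgb).mono (hdiag hrR)
  have hR' : HasMaj (BlockNorm.ofBlocks g (liftBlk (blk ∘ π) ι)) (BlockNorm.ofBlocks g (liftBlk (blk ∘ π) ι))
      (mmulOp (U.1 - ∑ μ, (fgradMat n' (τ' μ) (U.2 (Sum.inl μ)) ∘ ⇑(τ' μ).symm + fgradMat n' (τ' μ) (U.2 (Sum.inr μ)))))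
      (diagK fun _ => c35 * Fintype.card ι * a₀ * (1 + Fintype.card (J ⊕ J))) :=
    (hasMaj_byPartsMult_matrix₂ (blk ∘ π) (A := fun μ => U.2 (Sum.inl μ)) (B := fun μ => U.2 (Sum.inr μ)) hr'0 hr'0 hc' hga' hgb').mono (hdiag hrR)
  have hraθ : r' * θ ≤ c35 * Fintype.card ι * a₀ * θ := mul_le_mul_of_nonneg_right hra hθ
  have hoR : r' * θ + Fintype.card J * (r' * θ + r' * θ) ≤ c35 * Fintype.card ι * a₀ * (1 + Fintype.card (J ⊕ J)) * θ := by
    rw [hJ2]; nlinarith [mul_nonneg hnJ (mul_nonneg hr'0 hθ)]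
  have hDR : HasMaj (BlockNorm.ofBlocks g (liftBlk blk ι)) (BlockNorm.ofBlocks g (liftBlk (blk ∘ π) ι))
      (idef (pull (liftMap π ι)) (pull (liftMap π ι))
        (mmulOp (U.1 - ∑ μ, (fgradMat n' (τ' μ) (U.2 (Sum.inl μ)) ∘ ⇑(τ' μ).symm + fgradMat n' (τ' μ) (U.2 (Sum.inr μ)))))
        (mmulOp ((avgM₁ (J ⊕ J) ι π U).1 - ∑ μ, (fgradMat n (τ μ) ((avgM₁ (J ⊕ J) ι π U).2 (Sum.inl μ)) ∘ ⇑(τ μ).symm +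
          fgradMat n (τ μ) ((avgM₁ (J ⊕ J) ι π U).2 (Sum.inr μ))))))
      (diagK fun _ => c35 * Fintype.card ι * a₀ * (1 + Fintype.card (J ⊕ J)) * θ) :=
    (hasMaj_idef_byPartsMult_matrix₂ blk π (A := fun μ => (avgM₁ (J ⊕ J) ι π U).2 (Sum.inl μ)) (B := fun μ => (avgM₁ (J ⊕ J) ι π U).2 (Sum.inr μ))
      (A' := fun μ => U.2 (Sum.inl μ)) (B' := fun μ => U.2 (Sum.inr μ)) (mul_nonneg hr'0 hθ) hfc hfgT hfgb).mono (hdiag hoR)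
  -- coefficient letters: forward (translated along `e⁻¹`) and backward (translated along `e`)
  have hCa : ∀ μ, HasMaj (BlockNorm.ofBlocks g (liftBlk blk ι)) (BlockNorm.ofBlocks g (liftBlk blk ι)) (mmulOp ((avgM₁ (J ⊕ J) ι π U).2 (Sum.inl μ) ∘ ⇑(τ μ).symm))
      (diagK fun _ => c35 * Fintype.card ι * a₀) :=
    fun μ => (hasMaj_mmulOp_translate blk (A := fun μ => (avgM₁ (J ⊕ J) ι π U).2 (Sum.inl μ)) hr'0 (fun μ => ha (Sum.inl μ)) μ).mono (hdiag hra)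
  have hCa' : ∀ μ, HasMaj (BlockNorm.ofBlocks g (liftBlk (blk ∘ π) ι)) (BlockNorm.ofBlocks g (liftBlk (blk ∘ π) ι)) (mmulOp (U.2 (Sum.inl μ) ∘ ⇑(τ' μ).symm))
      (diagK fun _ => c35 * Fintype.card ι * a₀) :=
    fun μ => (hasMaj_mmulOp_translate (blk ∘ π) (A := fun μ => U.2 (Sum.inl μ)) hr'0 (fun μ => ha' (Sum.inl μ)) μ).mono (hdiag hra)
  have hCb : ∀ μ, HasMaj (BlockNorm.ofBlocks g (liftBlk blk ι)) (BlockNorm.ofBlocks g (liftBlk blk ι)) (mmulOp ((avgM₁ (J ⊕ J) ι π U).2 (Sum.inr μ) ∘ ⇑(τ μ)))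
      (diagK fun _ => c35 * Fintype.card ι * a₀) :=
    fun μ => (hasMaj_mmulOp_translate_fwd blk (B := fun μ => (avgM₁ (J ⊕ J) ι π U).2 (Sum.inr μ)) hr'0 (fun μ => ha (Sum.inr μ)) μ).mono (hdiag hra)
  have hCb' : ∀ μ, HasMaj (BlockNorm.ofBlocks g (liftBlk (blk ∘ π) ι)) (BlockNorm.ofBlocks g (liftBlk (blk ∘ π) ι)) (mmulOp (U.2 (Sum.inr μ) ∘ ⇑(τ' μ)))
      (diagK fun _ => c35 * Fintype.card ι * a₀) :=
    fun μ => (hasMaj_mmulOp_translate_fwd (blk ∘ π) (B := fun μ => U.2 (Sum.inr μ)) hr'0 (fun μ => ha' (Sum.inr μ)) μ).mono (hdiag hra)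
  have hoa0 : r' * θ ≤ c35 * Fintype.card ι * a₀ * (1 + Fintype.card (J ⊕ J)) * θ := by nlinarith [mul_nonneg (mul_nonneg hca0 hnJ2) hθ]
  have hDCa : ∀ μ, HasMaj (BlockNorm.ofBlocks g (liftBlk blk ι)) (BlockNorm.ofBlocks g (liftBlk (blk ∘ π) ι))
      (idef (pull (liftMap π ι)) (pull (liftMap π ι)) (mmulOp (U.2 (Sum.inl μ) ∘ ⇑(τ' μ).symm)) (mmulOp ((avgM₁ (J ⊕ J) ι π U).2 (Sum.inl μ) ∘ ⇑(τ μ).symm)))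
      (diagK fun _ => c35 * Fintype.card ι * a₀ * (1 + Fintype.card (J ⊕ J)) * θ) :=
    fun μ => (hasMaj_idef_mmulOp_translate blk π (A := fun μ => (avgM₁ (J ⊕ J) ι π U).2 (Sum.inl μ)) (A' := fun μ => U.2 (Sum.inl μ)) μ (mul_nonneg hr'0 hθ)
      (hfaT μ)).mono (hdiag hoa0)
  have hDCb : ∀ μ, HasMaj (BlockNorm.ofBlocks g (liftBlk blk ι)) (BlockNorm.ofBlocks g (liftBlk (blk ∘ π) ι))
      (idef (pull (liftMap π ι)) (pull (liftMap π ι)) (mmulOp (U.2 (Sum.inr μ) ∘ ⇑(τ' μ))) (mmulOp ((avgM₁ (J ⊕ J) ι π U).2 (Sum.inr μ) ∘ ⇑(τ μ))))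
      (diagK fun _ => c35 * Fintype.card ι * a₀ * (1 + Fintype.card (J ⊕ J)) * θ) :=
    fun μ => (hasMaj_idef_mmulOp_translate_fwd blk π (B := fun μ => (avgM₁ (J ⊕ J) ι π U).2 (Sum.inr μ)) (B' := fun μ => U.2 (Sum.inr μ)) μ (mul_nonneg hr'0 hθ)
      (hfbT μ)).mono (hdiag hoa0)
  -- rate-lowered `U ≡ 1` letters at `δ − σ`
  have hS1 : ∀ ν, HasMaj (BlockNorm.ofBlocks g (liftBlk blk ι)) (BlockNorm.ofBlocks g (liftBlk blk ι)) (G ∘ₗ fgradAdj n (liftEquiv (τ ν) ι))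
      (fun y y' => β * Real.exp (-((δ - σ) * g.dist y y'))) := fun ν => hasMaj_exp_mono hd hβ (by linarith) (hS ν)
  have hS1' : ∀ ν, HasMaj (BlockNorm.ofBlocks g (liftBlk (blk ∘ π) ι)) (BlockNorm.ofBlocks g (liftBlk (blk ∘ π) ι)) (G' ∘ₗ fgradAdj n' (liftEquiv (τ' ν) ι))
      (fun y y' => β * Real.exp (-((δ - σ) * g.dist y y'))) := fun ν => hasMaj_exp_mono hd hβ (by linarith) (hS' ν)
  have hDS1 : ∀ ν, HasMaj (BlockNorm.ofBlocks g (liftBlk blk ι)) (BlockNorm.ofBlocks g (liftBlk (blk ∘ π) ι))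
      (idef (pull (liftMap π ι)) (pull (liftMap π ι)) (G' ∘ₗ fgradAdj n' (liftEquiv (τ' ν) ι)) (G ∘ₗ fgradAdj n (liftEquiv (τ ν) ι)))
      (fun y y' => m₀ * θ * Real.exp (-((δ - σ) * g.dist y y'))) := fun ν => hasMaj_exp_mono hd (mul_nonneg hm₀ hθ) (by linarith) (hDS ν)
  have hSh1 : ∀ μ, HasMaj (BlockNorm.ofBlocks g (liftBlk blk ι)) (BlockNorm.ofBlocks g (liftBlk blk ι)) (pull (liftEquiv (τ μ) ι))
      (fun y y' => cT * Real.exp (-((δ - σ) * g.dist y y'))) := fun μ => hasMaj_exp_mono hd hcT (by linarith) (hSh μ)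
  have hSh1' : ∀ μ, HasMaj (BlockNorm.ofBlocks g (liftBlk (blk ∘ π) ι)) (BlockNorm.ofBlocks g (liftBlk (blk ∘ π) ι)) (pull (liftEquiv (τ' μ) ι))
      (fun y y' => cT * Real.exp (-((δ - σ) * g.dist y y'))) := fun μ => hasMaj_exp_mono hd hcT (by linarith) (hSh' μ)
  have hDSh1 : ∀ μ, HasMaj (BlockNorm.ofBlocks g (liftBlk (liftBlk blk ι) J)) (BlockNorm.ofBlocks g (liftBlk (blk ∘ π) ι))
      (idef (pull (liftMap π ι)) (pull (liftMap π ι)) (pull (liftEquiv (τ' μ) ι)) (pull (liftEquiv (τ μ) ι)) ∘ₗ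
        (mmulOp ((avgM₁ (J ⊕ J) ι π U).2 (Sum.inl μ) ∘ ⇑(τ μ).symm) ∘ₗ sumJ fun ν => G ∘ₗ fgradAdj n (liftEquiv (τ ν) ι)))
      (fun y y' => mT * θ * Real.exp (-((δ - σ) * g.dist y y'))) := fun μ => hasMaj_exp_mono hd (mul_nonneg hmT hθ) (by linarith) (hDSh μ)
  have hq2' : 1 * rowConst (Fintype.card J) β cT (c35 * Fintype.card ι * a₀) cr * cr * cr < 1 := by linarith
  -- FILE 3 ★★ at rate `δ − σ`, final rate `δ − 6σ`, the `C^b` slots LIVE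
  have hC0 : 0 ≤ bgConst β cr m₀ (c35 * (Fintype.card ι * (1 + Fintype.card (J ⊕ J)))) a₀ := bgConst_nonneg hβ hcr hm₀ (by positivity) ha₀
  have key := hasMaj_idef_entry2_of_letters (liftBlk blk ι) (liftMap π ι) htri hd hd0 hrow hσ hcr (δ := δ - σ) (ρ := δ - 6 * σ) (by linarith) (by linarith) hβ
    (by positivity) (by positivity) hcT hca0 (mul_nonneg hm₀ hθ) (mul_nonneg hC0 hθ) (by positivity) (mul_nonneg hmT hθ)
    hS1 hS1' hE' hR hR' hSh1 hSh1' hCa hCa' hCb hCb' hDS1 hDE hDR hDCa hDCb hDSh1 hq2'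
  have hA : 0 ≤ (1 * (1 - 1 * rowConst (Fintype.card J) β cT (c35 * Fintype.card ι * a₀) cr * cr * cr))⁻¹ := by
    rw [one_mul]; exact inv_nonneg.2 (by linarith)
  refine ((hasMaj_exp_comp_diagK (b₁ := BlockNorm.ofBlocks g (liftBlk blk ι)) (b₃ := BlockNorm.ofBlocks g (liftBlk (blk ∘ π) ι)) (liftBlk (liftBlk blk ι) J) ?_ key
    (hasMaj_injJ (liftBlk blk ι) ν))).mono ?_
  · set A := (1 * (1 - 1 * rowConst (Fintype.card J) β cT (c35 * Fintype.card ι * a₀) cr * cr * cr))⁻¹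
    set B := bgConst β cr m₀ (c35 * (Fintype.card ι * (1 + (Fintype.card (J ⊕ J) : ℝ)))) a₀
    unfold srcConst mKOf mBOf
    positivity
  · intro y y'
    refine le_of_eq ?_
    rw [bpConst2₂, show c35 * (Fintype.card ι : ℝ) * a₀ * (1 + (Fintype.card (J ⊕ J) : ℝ)) * θ = θ * (c35 * Fintype.card ι * a₀ * (1 + Fintype.card (J ⊕ J))) by ring,
      show m₀ * θ = θ * m₀ by ring, show mT * θ = θ * mT by ring,
      show bgConst β cr m₀ (c35 * ((Fintype.card ι : ℝ) * (1 + (Fintype.card (J ⊕ J) : ℝ)))) a₀ * θ =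
        θ * bgConst β cr m₀ (c35 * Fintype.card ι * (1 + Fintype.card (J ⊕ J))) a₀ by rw [mul_assoc]; ring,
      show c35 * (Fintype.card ι : ℝ) * a₀ * (1 + (Fintype.card (J ⊕ J) : ℝ)) = c35 * Fintype.card ι * a₀ * (1 + Fintype.card (J ⊕ J)) by rfl, mKOf_mul, mBOf_mul]
    ring

end Entry2

end Summit.QuantumFields.YangMills.BalabanUVNodes.N15.BackgroundLayer

end
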